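import Summits.SmoothPoincare4.SmoothPoincare4.Theses.EntropyRung
import Summits.SmoothPoincare4.SmoothPoincare4.Theorems.EntropyRungSubcylindricalExistenceGluingSmallScales
import Summits.SmoothPoincare4.SmoothPoincare4.Theorems.EntropyRungSubcylindricalExistenceGluingLargeScales
import Summits.SmoothPoincare4.SmoothPoincare4.Theorems.EntropyRungSubcylindricalExistenceGluingCutoffBound
import Summits.SmoothPoincare4.SmoothPoincare4.Theorems.EntropyRungSubcylindricalExistenceLogCutoff
import Literature.Geometry.Riemannian.PerelmanEntropyCutoff
import HarnessLib

/-!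
# All scales of the round-capped blow-up: the choice of constants
# (line `green-blowup-conformal-entropy`, crux `EntropyRung.SubcylindricalExistence`,
# stmt-SmoothPoincare4-10871; the analytic heart of Stub D `stub_conformalGluing`)

For Green data `(g, p, G)` in Schoen's flat gauge whose blow-up clears `ν_cyl + δ`, given (as
hypotheses, landed separately): the round cap factors `ψ_K` (S3), their exact cap clauses (S2), the
Yamabe–Sobolev inequality of the class (S4), and the volume bound `∫ψ_K⁴ ≤ C₁ + C₂K²` (S5), the
theorem `allScales_clause` chooses `ε = min(δ, 0.026)/8`, the cut-off level `S = e^T`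
(`T ≥ 1`, `T ≥ 16πC₆C_Y⁺/(Yε)`, `T ≥ G₀⁺ + a/r² + 1`), the gradient bound `Λ(S³)`, and
`K ≥ max(1, 2S³/ε, 48Λ(√C₁⁺ + √C₂⁺)/(Yε²))`, and proves: `ψ = ψ_K` is smooth, positive,
`L_g ψ > 0`, and the `ψ`-weighted `w²`-clause holds at level `ν_cyl + ε` at EVERY scale — small scales
`τ ≤ 3(√C₁⁺ + √C₂⁺K)/Y` by `GluingSmallScales.smallScales_clause` (with the cut-offs of H6
`logCutoff_exists` and the cost bound `gluingCutoffSqIntegral`), large scales by `gluingLargeScales`.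
Everything is proved; no definitions, no named facts.
-/

noncomputable section

set_option linter.dupNamespace false

open scoped Manifold ContDiff Topology RealInnerProductSpace
open Set Filter MeasureTheory
open Literature.Geometry.Lorentzian

namespace Summit.SmoothPoincare4.SmoothPoincare4.Theorems

namespace GluingAllScales

variable {M : Type} [TopologicalSpace M] [T2Space M] [SecondCountableTopology M]
  [ChartedSpace (EuclideanSpace ℝ (Fin 4)) M] [IsManifold (𝓡 4) ∞ M] [CompactSpace M]
  [T3Space M] [MeasurableSpace M] [BorelSpace M]
  (g : PseudoRiemannianMetric (𝓡 4) ∞ (EuclideanSpace ℝ (Fin 4)) (TangentSpace (𝓡 4) : M → Type _))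

set_option maxHeartbeats 800000 in
-- the statement carries seven long hypotheses and a long conclusion; elaboration of the final term
-- needs about 3× the default budget (all tactic steps are elementary)
/-- **The round-capped blow-up clears `ν_cyl` at all scales** (see the module docstring).
[cite: Perelman2002Entropy, §3.1] -/
theorem allScales_clause [g.HasLeviCivita] (hg : g.IsRiemannian) {p : M} {G : M → ℝ}
    (hGs : ContMDiffOn (𝓡 4) 𝓘(ℝ, ℝ) ∞ G {p}ᶜ) (hGpos : ∀ x, x ≠ p → 0 < G x)
    (hGlim : Tendsto G (𝓝[≠] p) atTop) {a r : ℝ} (ha : 0 < a) (hr : 0 < r)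
    (hsub : Metric.closedBall (extChartAt (𝓡 4) p p) r ⊆ (extChartAt (𝓡 4) p).target)
    (hflat : ∀ y ∈ Metric.closedBall (extChartAt (𝓡 4) p p) r, ∀ X W : EuclideanSpace ℝ (Fin 4),
      g.val ((extChartAt (𝓡 4) p).symm y)
        (mfderiv 𝓘(ℝ, EuclideanSpace ℝ (Fin 4)) (𝓡 4) (extChartAt (𝓡 4) p).symm y X)
        (mfderiv 𝓘(ℝ, EuclideanSpace ℝ (Fin 4)) (𝓡 4) (extChartAt (𝓡 4) p).symm y W) = ⟪X, W⟫)
    (hGform : ∀ y ∈ Metric.closedBall (extChartAt (𝓡 4) p p) r, y ≠ extChartAt (𝓡 4) p p →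
      G ((extChartAt (𝓡 4) p).symm y) = a / ‖y - extChartAt (𝓡 4) p p‖ ^ 2)
    {δ : ℝ} (hδ : 0 < δ)
    (hBlow : ∀ τ : ℝ, 0 < τ → ∀ w : M → ℝ, ContMDiff (𝓡 4) 𝓘(ℝ, ℝ) ∞ w → w =ᶠ[𝓝 p] 0 →
      ∫ x, (4 * Real.pi * τ) ^ (-(4 : ℝ) / 2) * (w x) ^ 2 * (G x) ^ 4
          ∂(riemannianMeasure (g.toContMDiffRiemannianMetric hg)) = 1 →
        Real.log 2 + Real.log Real.pi / 2 - 3 / 2 + δ ≤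
          ∫ x, (4 * τ * ((G x)⁻¹ ^ 2 * g.gradSq w x) - (w x) ^ 2 * Real.log ((w x) ^ 2)
            - 4 * (w x) ^ 2) * ((4 * Real.pi * τ) ^ (-(4 : ℝ) / 2) * (G x) ^ 4)
          ∂(riemannianMeasure (g.toContMDiffRiemannianMetric hg)))
    {Y : ℝ} (hY : 0 < Y)
    (hYSall : ∀ (ψ : M → ℝ), ContMDiff (𝓡 4) 𝓘(ℝ, ℝ) ∞ ψ → (∀ x, 0 < ψ x) →
      ∀ (u : M → ℝ), ContMDiff (𝓡 4) 𝓘(ℝ, ℝ) ∞ u →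
        Y * Real.sqrt (∫ x, u x ^ 4 * ψ x ^ 4 ∂(riemannianMeasure (g.toContMDiffRiemannianMetric hg))) ≤
          ∫ x, (6 * (ψ x ^ 2 * g.gradSq u x)
              + ψ x * (g.scalarCurvature x * ψ x - 6 * g.dalembertian ψ x) * u x ^ 2)
            ∂(riemannianMeasure (g.toContMDiffRiemannianMetric hg)))
    (hfac : ∀ K : ℝ, 0 < K → ∃ ψ : M → ℝ, ContMDiff (𝓡 4) 𝓘(ℝ, ℝ) ∞ ψ ∧ (∀ x, 0 < ψ x) ∧
      (∀ x, 0 < g.scalarCurvature x * ψ x - 6 * g.dalembertian ψ x) ∧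
      (∀ x, x ≠ p → ψ x = 4 * K * G x / (4 * K + G x)) ∧ ψ p = 4 * K)
    (hcapall : ∀ K : ℝ, 0 < K → ∀ ψ : M → ℝ, ContMDiff (𝓡 4) 𝓘(ℝ, ℝ) ∞ ψ →
      (∀ x, x ≠ p → ψ x = 4 * K * G x / (4 * K + G x)) → ψ p = 4 * K →
      ∀ τ : ℝ, 0 < τ → ∀ v : M → ℝ, ContMDiff (𝓡 4) 𝓘(ℝ, ℝ) ∞ v →
        tsupport v ⊆ {x | x ∈ (extChartAt (𝓡 4) p).source ∧
            extChartAt (𝓡 4) p x ∈ Metric.ball (extChartAt (𝓡 4) p p) r} →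
        ∫ x, (4 * Real.pi * τ) ^ (-(4 : ℝ) / 2) * (v x) ^ 2 * (ψ x) ^ 4
            ∂(riemannianMeasure (g.toContMDiffRiemannianMetric hg)) = 1 →
          Real.log 6 - 2 ≤
            ∫ x, (τ * ((ψ x ^ 3)⁻¹ * (g.scalarCurvature x * ψ x - 6 * g.dalembertian ψ x) * (v x) ^ 2
                  + 4 * ((ψ x)⁻¹ ^ 2 * g.gradSq v x))
                - (v x) ^ 2 * Real.log ((v x) ^ 2) - 4 * (v x) ^ 2)
                * ((4 * Real.pi * τ) ^ (-(4 : ℝ) / 2) * (ψ x) ^ 4)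
              ∂(riemannianMeasure (g.toContMDiffRiemannianMetric hg)))
    {C₁ C₂ : ℝ}
    (hvol : ∀ K : ℝ, 0 < K → ∀ ψ : M → ℝ, ContMDiff (𝓡 4) 𝓘(ℝ, ℝ) ∞ ψ →
      (∀ x, x ≠ p → ψ x = 4 * K * G x / (4 * K + G x)) → ψ p = 4 * K →
      ∫ x, (ψ x) ^ 4 ∂(riemannianMeasure (g.toContMDiffRiemannianMetric hg)) ≤ C₁ + C₂ * K ^ 2) :
    ∃ ψ : M → ℝ, ContMDiff (𝓡 4) 𝓘(ℝ, ℝ) ∞ ψ ∧ (∀ x, 0 < ψ x) ∧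
      (∀ x, 0 < g.scalarCurvature x * ψ x - 6 * g.dalembertian ψ x) ∧
      ∀ τ : ℝ, 0 < τ → ∀ w : M → ℝ, ContMDiff (𝓡 4) 𝓘(ℝ, ℝ) ∞ w →
        ∫ x, (4 * Real.pi * τ) ^ (-(4 : ℝ) / 2) * (w x) ^ 2 * (ψ x) ^ 4
            ∂(riemannianMeasure (g.toContMDiffRiemannianMetric hg)) = 1 →
          Real.log 2 + Real.log Real.pi / 2 - 3 / 2 + min δ 0.026 / 8 ≤
            ∫ x, (τ * ((ψ x ^ 3)⁻¹ * (g.scalarCurvature x * ψ x - 6 * g.dalembertian ψ x) * (w x) ^ 2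
                  + 4 * ((ψ x)⁻¹ ^ 2 * g.gradSq w x))
              - (w x) ^ 2 * Real.log ((w x) ^ 2) - 4 * (w x) ^ 2)
              * ((4 * Real.pi * τ) ^ (-(4 : ℝ) / 2) * (ψ x) ^ 4)
            ∂(riemannianMeasure (g.toContMDiffRiemannianMetric hg)) := by
  haveI : Nonempty M := ⟨p⟩
  -- ε
  generalize hε8 : min δ 0.026 / 8 = ε
  have hε : 0 < ε := by rw [← hε8]; positivity
  have hεδ : 8 * ε ≤ δ := by rw [← hε8]; linarith [min_le_left δ 0.026]
  have hε26 : 8 * ε ≤ 0.026 := by rw [← hε8]; linarith [min_le_right δ 0.026]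
  -- the unit cap factor (gradient bound) and the cut-off constant
  obtain ⟨ψ₁, hψ₁, hψ₁pos, -, hψ₁G, -⟩ := hfac 1 one_pos
  obtain ⟨C₆, hC₆, hcut⟩ := logCutoff_exists
  have hGc : ContinuousOn G {p}ᶜ := hGs.continuousOn
  obtain ⟨G₀, hG₀⟩ := GluingConstants.exists_capture (p := p) hGc hr
  -- the cost constant
  have hCst0 : 0 ≤ max (3 * (4 + 2 * Real.log (4 * Real.pi) - 2 * Real.log Y) + 6 * Real.log 6 - 6) 0 :=
    le_max_right _ _
  -- `T` and `S = e^T`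
  obtain ⟨T, hT1, hTA, hTG⟩ : ∃ T : ℝ, 1 ≤ T ∧
      16 * Real.pi * C₆ * max (3 * (4 + 2 * Real.log (4 * Real.pi) - 2 * Real.log Y) + 6 * Real.log 6 - 6) 0
        / (Y * ε) ≤ T ∧ max G₀ 0 + a / r ^ 2 + 1 ≤ T :=
    ⟨max 1 (max _ _), le_max_left _ _, (le_max_left _ _).trans (le_max_right _ _),
      (le_max_right _ _).trans (le_max_right _ _)⟩
  have hT0 : 0 < T := by linarith
  obtain ⟨S, hS1, hlogS, hST⟩ : ∃ S : ℝ, 1 < S ∧ Real.log S = T ∧ T + 1 ≤ S :=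
    ⟨Real.exp T, Real.one_lt_exp_iff.2 hT0, Real.log_exp T, Real.add_one_le_exp T⟩
  have hS0 : 0 < S := by linarith
  have haS : a / r ^ 2 < S := by linarith [le_max_right G₀ 0]
  have hG₀S : G₀ ≤ S := by linarith [le_max_left G₀ 0, div_nonneg ha.le (sq_nonneg r)]
  -- the open chart ball and its capture property
  have hpU : p ∈ {x | x ∈ (extChartAt (𝓡 4) p).source ∧
      extChartAt (𝓡 4) p x ∈ Metric.ball (extChartAt (𝓡 4) p p) r} :=
    ⟨mem_extChartAt_source p, Metric.mem_ball_self hr⟩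
  have hcaptS : ∀ x, x ≠ p → S ≤ G x →
      x ∈ (extChartAt (𝓡 4) p).source ∧ extChartAt (𝓡 4) p x ∈ Metric.ball (extChartAt (𝓡 4) p p) r :=
    fun x hx hGx ↦ hG₀ x hx (hG₀S.trans hGx)
  -- `Λ`
  obtain ⟨Λ, hΛ0, hΛ⟩ := GluingConstants.exists_coreGradBound g hg hGpos hψ₁ hψ₁pos hψ₁G
    (S := S ^ 3) (by positivity)
  -- `K`
  have hC₁' : 0 ≤ max C₁ 0 := le_max_right _ _
  have hC₂' : 0 ≤ max C₂ 0 := le_max_right _ _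
  obtain ⟨K, hK1, hKS, hKΛ⟩ : ∃ K : ℝ, 1 ≤ K ∧ 2 * S ^ 3 / ε ≤ K ∧
      48 * Λ * (Real.sqrt (max C₁ 0) + Real.sqrt (max C₂ 0)) / (Y * ε ^ 2) ≤ K :=
    ⟨max 1 (max _ _), le_max_left _ _, (le_max_left _ _).trans (le_max_right _ _),
      (le_max_right _ _).trans (le_max_right _ _)⟩
  have hK0 : 0 < K := by linarith
  -- `ψ = ψ_K`
  obtain ⟨ψ, hψ, hψpos, hLψ, hψG, hψp⟩ := hfac K hK0
  refine ⟨ψ, hψ, hψpos, hLψ, ?_⟩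
  -- volume and the base scale
  have hVpos := GluingConstants.integral_pow_four_pos' g hg hψ.continuous hψpos
  have hVle : ∫ x, ψ x ^ 4 ∂(riemannianMeasure (g.toContMDiffRiemannianMetric hg)) ≤
      max C₁ 0 + max C₂ 0 * K ^ 2 := by
    refine (hvol K hK0 ψ hψ hψG hψp).trans ?_
    have h2 := mul_le_mul_of_nonneg_right (le_max_left C₂ 0) (sq_nonneg K)
    linarith [le_max_left C₁ 0]
  have hsqV : Real.sqrt (∫ x, ψ x ^ 4 ∂(riemannianMeasure (g.toContMDiffRiemannianMetric hg))) ≤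
      Real.sqrt (max C₁ 0) + Real.sqrt (max C₂ 0) * K :=
    (Real.sqrt_le_sqrt hVle).trans (GluingConstants.sqrt_quad_le hC₁' hC₂' hK0.le)
  have hτ₀le : 3 * Real.sqrt (∫ x, ψ x ^ 4 ∂(riemannianMeasure (g.toContMDiffRiemannianMetric hg))) / Y ≤
      3 * (Real.sqrt (max C₁ 0) + Real.sqrt (max C₂ 0) * K) / Y :=
    div_le_div_of_nonneg_right (by linarith) hY.le
  have hτ₀pos : 0 < 3 * Real.sqrt (∫ x, ψ x ^ 4 ∂(riemannianMeasure (g.toContMDiffRiemannianMetric hg))) / Y := by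
    have := Real.sqrt_pos.2 hVpos
    positivity
  -- the cut-offs at the level `S` and the cost bound
  obtain ⟨χ₁, χ₂, hχ₁, hχ₂, h1, hone, hzero, hχ₁p, hbound, -, -⟩ := hcut M g hg p G hGs hGpos hGlim S hS1
  have hQ := gluingCutoffSqIntegral M g hg p G hGs a r ha hr hsub hflat hGform C₆ S hC₆.le hS1 haS χ₁ χ₂ hχ₁ hχ₂
    h1 hone hzero hχ₁p hbound hGlim hcaptS
  rw [hlogS] at hQ
  have hΘ : Real.sqrt (∫ x, (g.gradSq χ₁ x + g.gradSq χ₂ x) ^ 2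
      ∂(riemannianMeasure (g.toContMDiffRiemannianMetric hg))) ≤ C₆ / T ^ 2 * (4 * Real.pi * Real.sqrt T) := by
    rw [Real.sqrt_le_iff]
    refine ⟨by positivity, hQ.trans_eq ?_⟩
    rw [mul_pow, mul_pow, mul_pow, Real.sq_sqrt hT0.le]
    ring
  have hcost : 4 / Y * max (3 * (4 + 2 * Real.log (4 * Real.pi) - 2 * Real.log Y) + 6 * Real.log 6 - 6) 0 *
      (C₆ / T ^ 2 * (4 * Real.pi * Real.sqrt T)) ≤ ε := by
    have hsqT : Real.sqrt T ≤ T := Real.sqrt_le_iff.2 ⟨hT0.le, by nlinarith⟩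
    have h1' : C₆ / T ^ 2 * (4 * Real.pi * Real.sqrt T) ≤ 4 * Real.pi * C₆ / T := by
      calc C₆ / T ^ 2 * (4 * Real.pi * Real.sqrt T) ≤ C₆ / T ^ 2 * (4 * Real.pi * T) := by
            gcongr
        _ = 4 * Real.pi * C₆ / T := by field_simp
    have h2' : 4 / Y * max (3 * (4 + 2 * Real.log (4 * Real.pi) - 2 * Real.log Y) + 6 * Real.log 6 - 6) 0 *
        (4 * Real.pi * C₆ / T) ≤ ε := by
      rw [show 4 / Y * max (3 * (4 + 2 * Real.log (4 * Real.pi) - 2 * Real.log Y) + 6 * Real.log 6 - 6) 0 *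
          (4 * Real.pi * C₆ / T) = (16 * Real.pi * C₆ *
          max (3 * (4 + 2 * Real.log (4 * Real.pi) - 2 * Real.log Y) + 6 * Real.log 6 - 6) 0 / (Y * ε)) * ε / T by
          field_simp; ring]
      rw [div_le_iff₀ hT0]
      have := mul_le_mul_of_nonneg_right hTA hε.le
      nlinarith
    exact (mul_le_mul_of_nonneg_left h1' (by positivity)).trans h2'
  -- the largeness condition at the top small scale
  have hKT : 16 * (3 * (Real.sqrt (max C₁ 0) + Real.sqrt (max C₂ 0) * K) / Y) * Λ ≤ ε ^ 2 * K ^ 2 := by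
    have hYε : 0 < Y * ε ^ 2 := mul_pos hY (pow_pos hε 2)
    have hKΛ' : 48 * Λ * (Real.sqrt (max C₁ 0) + Real.sqrt (max C₂ 0)) ≤ K * (Y * ε ^ 2) :=
      (div_le_iff₀ hYε).1 hKΛ
    have hmono : Real.sqrt (max C₁ 0) + Real.sqrt (max C₂ 0) * K ≤
        (Real.sqrt (max C₁ 0) + Real.sqrt (max C₂ 0)) * K := by
      have h := mul_le_mul_of_nonneg_left hK1 (Real.sqrt_nonneg (max C₁ 0))
      rw [mul_one] at h
      linarith [h]
    rw [show 16 * (3 * (Real.sqrt (max C₁ 0) + Real.sqrt (max C₂ 0) * K) / Y) * Λ =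
        48 * Λ * (Real.sqrt (max C₁ 0) + Real.sqrt (max C₂ 0) * K) / Y by ring,
      div_le_iff₀ hY]
    calc 48 * Λ * (Real.sqrt (max C₁ 0) + Real.sqrt (max C₂ 0) * K)
        ≤ 48 * Λ * ((Real.sqrt (max C₁ 0) + Real.sqrt (max C₂ 0)) * K) :=
          mul_le_mul_of_nonneg_left hmono (by positivity)
      _ = 48 * Λ * (Real.sqrt (max C₁ 0) + Real.sqrt (max C₂ 0)) * K := by ring
      _ ≤ K * (Y * ε ^ 2) * K := mul_le_mul_of_nonneg_right hKΛ' hK0.le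
      _ = ε ^ 2 * K ^ 2 * Y := by ring
  -- small scales
  have hsmall := GluingSmallScales.smallScales_clause g hg hGs hGpos hGlim hBlow hK0 hψ hψpos hψG hLψ hY
    (hYSall ψ hψ hψpos) hpU (hcapall K hK0 ψ hψ hψG hψp) hS1 hΛ0 hΛ hχ₁ hχ₂ h1 hone hzero hχ₁p
    (fun x hx hGx ↦ hcaptS x hx hGx) hε hεδ hε26 hΘ hcost hKS hKT
  -- large scales, from the clause at the base scale
  have hlarge := gluingLargeScales M g hg Y hY ψ hψ hψpos hLψ (hYSall ψ hψ hψpos) hVpos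
    (Real.log 2 + Real.log Real.pi / 2 - 3 / 2 + ε) (fun w hw hn ↦ hsmall _ hτ₀pos hτ₀le w hw hn)
  -- all scales
  intro τ hτ w hw hnorm
  by_cases hcase : τ ≤ 3 * Real.sqrt (∫ x, ψ x ^ 4 ∂(riemannianMeasure (g.toContMDiffRiemannianMetric hg))) / Y
  · exact hsmall τ hτ (hcase.trans hτ₀le) w hw hnorm
  · exact hlarge τ (le_of_not_ge hcase) w hw hnorm

end GluingAllScales


/-- **From the `w²`-form to the `e^{−f}`-form of the weighted clause** (registered sub-goal
`gluingExpForm` of Stub D of line `green-blowup-conformal-entropy`): at a fixed scale `τ`, a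
`ψ`-weighted clause for all smooth `w` gives the clause for all smooth `f`, via `w = e^{−f/2}`
(`|∇w|²_g = ¼ e^{−f}|∇f|²_g`, `log w² = −f`). [cite: Perelman2002Entropy, §3.1] -/
theorem gluingExpForm :
    ∀ (M : Type) [TopologicalSpace M] [T2Space M] [SecondCountableTopology M]
      [ChartedSpace (EuclideanSpace ℝ (Fin 4)) M] [IsManifold (𝓡 4) ∞ M] [CompactSpace M]
      [T3Space M] [MeasurableSpace M] [BorelSpace M]
      (g : PseudoRiemannianMetric (𝓡 4) ∞ (EuclideanSpace ℝ (Fin 4)) (TangentSpace (𝓡 4) : M → Type _))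
      [g.HasLeviCivita] (hg : g.IsRiemannian) (ψ : M → ℝ), (∀ x, 0 < ψ x) → ∀ (L τ : ℝ), 0 < τ →
      (∀ w : M → ℝ, ContMDiff (𝓡 4) 𝓘(ℝ, ℝ) ∞ w →
        ∫ x, (4 * Real.pi * τ) ^ (-(4 : ℝ) / 2) * (w x) ^ 2 * (ψ x) ^ 4
            ∂(riemannianMeasure (g.toContMDiffRiemannianMetric hg)) = 1 →
          L ≤ ∫ x, (τ * ((ψ x ^ 3)⁻¹ * (g.scalarCurvature x * ψ x - 6 * g.dalembertian ψ x) * (w x) ^ 2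
                + 4 * ((ψ x)⁻¹ ^ 2 * g.gradSq w x))
              - (w x) ^ 2 * Real.log ((w x) ^ 2) - 4 * (w x) ^ 2)
              * ((4 * Real.pi * τ) ^ (-(4 : ℝ) / 2) * (ψ x) ^ 4)
            ∂(riemannianMeasure (g.toContMDiffRiemannianMetric hg))) →
      ∀ f : M → ℝ, ContMDiff (𝓡 4) 𝓘(ℝ, ℝ) ∞ f →
        ∫ x, (4 * Real.pi * τ) ^ (-(4 : ℝ) / 2) * Real.exp (-f x) * ψ x ^ 4
            ∂(riemannianMeasure (g.toContMDiffRiemannianMetric hg)) = 1 →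
          L ≤ ∫ x, (τ * ((ψ x ^ 3)⁻¹ * (g.scalarCurvature x * ψ x - 6 * g.dalembertian ψ x) +
                  (ψ x ^ 2)⁻¹ * g.gradSq f x) + f x - 4) *
                ((4 * Real.pi * τ) ^ (-(4 : ℝ) / 2) * Real.exp (-f x)) * ψ x ^ 4
              ∂(riemannianMeasure (g.toContMDiffRiemannianMetric hg)) := by
  intro M _ _ _ _ _ _ _ _ _ g _ hg ψ hψpos L τ hτ hall f hf hnormf
  have hfm : ContMDiff (𝓡 4) 𝓘(ℝ, ℝ) ∞ (fun x ↦ -f x / 2) := hf.neg.div_const 2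
  have hw : ContMDiff (𝓡 4) 𝓘(ℝ, ℝ) ∞ (fun x ↦ Real.exp (-f x / 2)) := Real.contDiff_exp.comp_contMDiff hfm
  have hw2 : ∀ x, Real.exp (-f x / 2) ^ 2 = Real.exp (-f x) := fun x ↦ by
    rw [sq, ← Real.exp_add]; ring_nf
  have hnormw : ∫ x, (4 * Real.pi * τ) ^ (-(4 : ℝ) / 2) * (Real.exp (-f x / 2)) ^ 2 * (ψ x) ^ 4
      ∂(riemannianMeasure (g.toContMDiffRiemannianMetric hg)) = 1 := by
    rw [← hnormf]
    refine integral_congr_ae (ae_of_all _ fun x ↦ ?_)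
    dsimp only
    rw [hw2 x]
  have h := hall (fun x ↦ Real.exp (-f x / 2)) hw hnormw
  refine h.trans_eq (integral_congr_ae (ae_of_all _ fun x ↦ ?_))
  dsimp only
  have hfx : MDifferentiableAt (𝓡 4) 𝓘(ℝ, ℝ) f x := (hf x).mdifferentiableAt (by simp)
  have hd : HasDerivAt (fun t : ℝ ↦ Real.exp (-t / 2)) (Real.exp (-f x / 2) * (-1 / 2)) (f x) := by
    have h1 : HasDerivAt (fun t : ℝ ↦ -t / 2) (-1 / 2) (f x) := by
      simpa using ((hasDerivAt_id (f x)).neg).div_const 2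
    exact h1.exp
  have hgradw : g.gradSq (fun y ↦ Real.exp (-f y / 2)) x = (Real.exp (-f x / 2) * (-1 / 2)) ^ 2 * g.gradSq f x := by
    rw [show (fun y ↦ Real.exp (-f y / 2)) = (fun t : ℝ ↦ Real.exp (-t / 2)) ∘ f from rfl]
    exact g.gradSq_real_comp hd hfx
  have hψx : ψ x ≠ 0 := (hψpos x).ne'
  rw [hgradw, mul_pow, hw2 x, Real.log_exp]
  field_simp
  ring

end Summit.SmoothPoincare4.SmoothPoincare4.Theorems

end
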